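import Summits.Ventures.PercRepro.SevenThreePhi

/-!
# PercRepro — the `(7,3)` cell: the flats of a circuit and their weighted counts (p3, gen 15)

For a circuit `C` of `M` with `c = |C|` points, the restriction `M|C` is the uniform matroid `U_{c−1,c}`: every proper
subset is independent and every `(c − 1)`-subset spans `C`. Hence the rank-`r` flats of `M|C` are the `r`-subsets for
`r ≤ c − 2`, the single flat `C` at rank `c − 1`, and none at rank `≥ c` (`flatsRestr_isCircuit_of_le` / `_top` /
`_of_ge`), so the weighted counts of `SevenThreePhi.lean` are `Φ_r(C) = C(c, r)`, `6`, `0` (`Phi_isCircuit_of_le` /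
`_top` / `_of_ge`). With the coloop direct sum this gives Lemma 24.1 of `MINE2-RLS.md` primally: the denominator of a
witness of nullity one is `Σ_j C(|Y|, j)·Φ_{3−j}(C)` over the coloops `Y` (`P3-C025-seven-three-plan.md` §6, M2).
-/

namespace PercRepro

namespace SevenThree

open Finset ThmH SixThree

variable {α : Type*} [DecidableEq α] {M : Matroid α} [M.Finite]

omit [DecidableEq α] [M.Finite] in
/-- A proper subset of a circuit is independent, so its rank is its size. -/
theorem eRk_of_ssubset_isCircuit {C F : Finset α} (hC : M.IsCircuit (C : Set α)) (hF : F ⊂ C) :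
    M.eRk (F : Set α) = (F.card : ℕ∞) := by
  have hind : M.Indep (F : Set α) := hC.ssubset_indep (Finset.coe_ssubset.2 hF)
  rw [hind.eRk_eq_encard, Set.encard_coe_eq_coe_finsetCard]

omit [DecidableEq α] in
/-- A circuit with `c` points has rank `c − 1`. -/
theorem eRk_isCircuit {C : Finset α} (hC : M.IsCircuit (C : Set α)) :
    M.eRk (C : Set α) = ((C.card - 1 : ℕ) : ℕ∞) := by
  have h := hC.eRk_add_one_eq
  rw [Set.encard_coe_eq_coe_finsetCard] at h
  obtain ⟨k, hk, -⟩ := ThmH.eRk_eq_nat M C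
  rw [hk] at h ⊢
  have h' : ((k + 1 : ℕ) : ℕ∞) = (C.card : ℕ∞) := by rw [Nat.cast_succ]; exact h
  have h'' : k + 1 = C.card := by exact_mod_cast h'
  congr 1
  omega

/-- **Flats of a circuit, low ranks**: for `r ≤ c − 2` the rank-`r` flats of `M|C` are exactly the `r`-subsets of `C`. -/
theorem flatsRestr_isCircuit_of_le {C : Finset α} (hC : M.IsCircuit (C : Set α)) {r : ℕ}
    (hr : r + 2 ≤ C.card) : flatsRestr M C r = C.powersetCard r := by
  ext F
  rw [mem_flatsRestr, Finset.mem_powersetCard]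
  constructor
  · rintro ⟨hFC, hFr, -⟩
    refine ⟨hFC, ?_⟩
    have hne : F ≠ C := by
      rintro rfl
      rw [eRk_isCircuit hC] at hFr
      have : F.card - 1 = r := by exact_mod_cast hFr
      omega
    have hss : F ⊂ C := Finset.ssubset_iff_subset_ne.2 ⟨hFC, hne⟩
    rw [eRk_of_ssubset_isCircuit hC hss] at hFr
    exact_mod_cast hFr
  · rintro ⟨hFC, hcard⟩
    have hss : F ⊂ C := by
      rw [Finset.ssubset_iff_subset_ne]
      refine ⟨hFC, ?_⟩
      rintro rfl
      omega
    refine ⟨hFC, by rw [eRk_of_ssubset_isCircuit hC hss, hcard], ?_⟩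
    intro e heC heF
    have hss' : insert e F ⊂ C := by
      rw [Finset.ssubset_iff_subset_ne]
      refine ⟨Finset.insert_subset heC hFC, ?_⟩
      intro h
      have := congrArg Finset.card h
      rw [Finset.card_insert_of_notMem heF, hcard] at this
      omega
    rw [eRk_of_ssubset_isCircuit hC hss', Finset.card_insert_of_notMem heF, hcard]

/-- **Flats of a circuit, top rank**: the only rank-`(c − 1)` flat of `M|C` is `C` itself (a `(c − 1)`-subset spans `C`). -/
theorem flatsRestr_isCircuit_top {C : Finset α} (hC : M.IsCircuit (C : Set α)) :
    flatsRestr M C (C.card - 1) = {C} := by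
  ext F
  rw [mem_flatsRestr, Finset.mem_singleton]
  constructor
  · rintro ⟨hFC, hFr, hflat⟩
    by_contra hne
    have hss : F ⊂ C := Finset.ssubset_iff_subset_ne.2 ⟨hFC, hne⟩
    rw [eRk_of_ssubset_isCircuit hC hss] at hFr
    have hcard : F.card = C.card - 1 := by exact_mod_cast hFr
    obtain ⟨e, heC, heF⟩ := Finset.exists_of_ssubset hss
    have h1 := hflat e heC heF
    have hcpos : 1 ≤ C.card := Finset.card_pos.2 ⟨e, heC⟩
    have hins : insert e F = C := by
      apply Finset.eq_of_subset_of_card_le (Finset.insert_subset heC hFC)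
      rw [Finset.card_insert_of_notMem heF, hcard]
      omega
    rw [hins, eRk_isCircuit hC] at h1
    have : C.card - 1 = C.card - 1 + 1 := by exact_mod_cast h1
    omega
  · rintro rfl
    refine ⟨subset_refl _, eRk_isCircuit hC, ?_⟩
    intro e heC heF
    exact absurd heC heF

/-- **Flats of a circuit, high ranks**: `M|C` has no flat of rank `≥ c`. -/
theorem flatsRestr_isCircuit_of_ge {C : Finset α} (hC : M.IsCircuit (C : Set α)) {r : ℕ}
    (hr : C.card ≤ r) : flatsRestr M C r = ∅ := by
  ext F
  simp only [mem_flatsRestr, Finset.notMem_empty, iff_false]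
  rintro ⟨hFC, hFr, -⟩
  have h := M.eRk_mono (Finset.coe_subset.2 hFC)
  rw [hFr, eRk_isCircuit hC] at h
  have h' : r ≤ C.card - 1 := by exact_mod_cast h
  have hc : 1 ≤ C.card := by
    rcases Nat.eq_zero_or_pos C.card with h0 | h0
    · exfalso
      have hCe : C = ∅ := Finset.card_eq_zero.1 h0
      have hne := hC.nonempty
      rw [hCe, Finset.coe_empty] at hne
      exact Set.not_nonempty_empty hne
    · exact h0
  omega

/-- `Φ_r(C) = C(c, r)` for `r ≤ c − 2` (the `r`-subsets, each of weight `6^0 = 1`). -/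
theorem Phi_isCircuit_of_le {C : Finset α} (hC : M.IsCircuit (C : Set α)) {r : ℕ} (hr : r + 2 ≤ C.card) :
    Phi M r C = ((C.card.choose r : ℕ) : ℚ) := by
  unfold Phi
  rw [flatsRestr_isCircuit_of_le hC hr]
  rw [Finset.sum_congr rfl (fun F hF => by
    rw [(Finset.mem_powersetCard.1 hF).2, Nat.sub_self, pow_zero])]
  rw [Finset.sum_const, Finset.card_powersetCard]
  simp

/-- `Φ_{c−1}(C) = 6` (the single flat `C`, of weight `6^{c − (c − 1)} = 6`). -/
theorem Phi_isCircuit_top {C : Finset α} (hC : M.IsCircuit (C : Set α)) :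
    Phi M (C.card - 1) C = 6 := by
  have hc : 1 ≤ C.card := by
    obtain ⟨e, he⟩ := hC.nonempty
    exact Finset.card_pos.2 ⟨e, Finset.mem_coe.1 he⟩
  unfold Phi
  rw [flatsRestr_isCircuit_top hC, Finset.sum_singleton]
  have : C.card - (C.card - 1) = 1 := by omega
  rw [this, pow_one]

/-- `Φ_r(C) = 0` for `r ≥ c`. -/
theorem Phi_isCircuit_of_ge {C : Finset α} (hC : M.IsCircuit (C : Set α)) {r : ℕ} (hr : C.card ≤ r) :
    Phi M r C = 0 := by
  unfold Phi
  rw [flatsRestr_isCircuit_of_ge hC hr, Finset.sum_empty]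

/-- **Lemma 24.1, primal form**: the denominator of `S = C ∪ Y` for a circuit `C` and a set `Y` of coloops of `M|S`
(each `y ∈ Y` outside `cl(C ∪ (Y ∖ y))`) is `D(S) = Σ_{j ≤ 3} C(|Y|, j)·Φ_{3−j}(C)` — with `Φ_r(C) = C(c, r) / 6 / 0`
by rank. -/
theorem D_circuit_union_coloops {C : Finset α} (hC : M.IsCircuit (C : Set α)) (Y : Finset α) (hY : Y ⊆ gr M)
    (hcol : ∀ y ∈ Y, y ∉ M.closure ((C ∪ Y.erase y : Finset α) : Set α)) :
    D M (C ∪ Y) = ∑ j ∈ Finset.range 4, ((Y.card.choose j : ℕ) : ℚ) * Phi M (3 - j) C := by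
  have hCg : C ⊆ gr M := by
    rw [← Finset.coe_subset, coe_gr]
    exact hC.subset_ground
  rw [D_eq_Phi_three (Finset.union_subset hCg hY), Phi_union_of_coloops hCg Y hY hcol 3]

end SevenThree

end PercRepro
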